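import Literature.MathematicalPhysics.StatisticalMechanics.Theil2006LatticeCharacterization
import Literature.MathematicalPhysics.StatisticalMechanics.Theil2006Periodic
import HarnessLib

/-!
# Theil 2006, §3: the point symmetries of `A₂` and the «`R = Id`, `τ = 0`» step of Corollary 1.3
— proved

Topic `Literature/MathematicalPhysics/StatisticalMechanics`; companion of `Theil2006.lean`,
`Theil2006Periodic.lean` (F. Theil, *A proof of crystallization in two dimensions*, Comm. Math.
Phys. **262** (2006) 209–236; accepted preprint of 26 Aug 2005, lit store `paper:url-69bff4ce1e30`)
and of `Theil2006LatticeCharacterization.lean` (the p. 13 statement «(42)–(43) ⇒ `RΩ + τ = A₂`»).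

## Source (§3, preprint pp. 13–15)

Both boundary-condition results of the paper end with the same two sentences. Proof of
Theorem 1.2, p. 14: «Hence, the set `Ω = {y_min(x) | x ∈ A₂}` satisfies (42) and (43) and
consequentially `RΩ + τ = A₂` for a rotation `R ∈ SO(2)` and a translation `τ ∈ ℝ²`. By the
periodicity of `y_min` we can choose `R = Id`, this is precisely the claim». Proof of
Corollary 1.3, p. 15: «… consequentially `RΩ + τ = A₂` for a rotation `R ∈ SO(2)` and a translation
`τ ∈ ℝ²`. By the periodicity of `y_per` we can choose `R = Id`. Since `y_per(x) = y_min(x)` for all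
`x ∈ Y` we obtain that `τ = 0` and `y_min(x) = x` for all `x ∈ A₂`.» For PERIODIC configurations
the inference «`R = Id`» is false in general (coincidence rotations, `Theil2006Periodic.lean`:
the `Σ7` competitor); for configurations that are CLAMPED (`y(x) = x`) on part of the lattice it is
correct, and this file proves the lattice-symmetry facts that make it so (no named fact, no
`sorry`):

* `Theil2006.image_triangularLattice_eq` — a linear isometry `R` of `ℝ²` with `R b₁ ∈ A₂` and
  `R b₂ ∈ A₂` maps `A₂` ONTO `A₂` (`R A₂ ⊆ A₂` by linearity; `R` permutes the six unit vectors
  of `A₂`, a finite set it maps injectively into itself, so `R⁻¹ b₁, R⁻¹ b₂ ∈ A₂` too);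
* `Theil2006.eq_triangularLattice_of_corner_mem` — if `RΩ + τ = A₂` (`R` a linear isometry) and
  `Ω` contains one undistorted corner `x₀, x₀ + b₁, x₀ + b₂` of `A₂`, then `Ω = A₂`
  (`R b₁, R b₂ ∈ A₂ - A₂ = A₂`, so `R A₂ = A₂`, `τ = (R x₀ + τ) - R x₀ ∈ A₂`, `Ω = R⁻¹(A₂ - τ)`);
  `eq_triangularLattice_of_cofinite` — in particular if `Ω ⊇ A₂` minus finitely many points;
* `Theil2006.IsClampedOutside.range_eq_triangularLattice_of_rotation` — for `y : A₂ → ℝ²`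
  clamped off a finite set `𝒜` (`Theil2006.IsClampedOutside`, the constraint `Y_𝒜^Dir` of
  Corollary 1.3), the rotation form `{R y(x) + τ} = A₂` (what p. 13 delivers) upgrades to
  `{y(x) | x ∈ A₂} = A₂`, the conclusion of `Theil2006_dirichletGroundStates` — the honest content
  of «we can choose `R = Id` … we obtain that `τ = 0`» (the printed «`y_min(x) = x` for all `x`»
  over-claims: relabelings inside `𝒜` are ground states too; the corollary's own statement is the
  set identity, which is what is proved here).

Appended once the p. 13 statement (`Theil2006LatticeCharacterization.lean`) was in the tree:

* `Theil2006.IsClampedOutside.range_eq_triangularLattice` — (42) ∧ (43) for the image of a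
  clamped `y` ⇒ `{y(x) | x ∈ A₂} = A₂` (p. 13 gives `R`, `τ`; the clamped far field absorbs
  them), and `…_iff`: for clamped `y` this conclusion is EQUIVALENT to (42) ∧ (43) (`A₂` itself
  satisfies them);
* reductions (ours): `Theil2006_periodicGroundStates_upToRotation_of_local` and
  `Theil2006_dirichletGroundStates_of_local` — the named facts of `Theil2006Periodic.lean` /
  `Theil2006.lean` follow from (42) ∧ (43) for the images of the respective ground states (p. 14:
  «Ω = {y_min(x) | x ∈ A₂} satisfies (42) and (43) and consequentially …»), isolating the analytic
  content of §3 ((44)–(46): `#X̃_min = L²`, `∂X̃_min = ∅`, unit short bonds) as what remains.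

Auxiliary: `A₂` is an additive subgroup (`sub_mem_triangularLattice`, `add_mem_triangularLattice`),
its unit vectors are `triPoint ξ`, `ξ ∈ unitShell` (`norm_triPoint_eq_one_iff`, from
`Theil2006EnergyBounds.lean`), and `R (m b₁ + n b₂) = m R b₁ + n R b₂`
(`map_triPoint_mem_triangularLattice`). Everything here is proved; no new facts (D-0026).
[cite: Theil2006, §3 Proofs of Theorem 1.2 and Corollary 1.3, the «R = Id» step (preprint pp. 14–15)]
-/

noncomputable section

namespace Literature.MathematicalPhysics.StatisticalMechanics

namespace Theil2006

/-- `A₂` is closed under subtraction (it is the additive subgroup `triPoint(ℤ²)`).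
[cite: Theil2006, §1 (`A₂ = ½ (2 1; 0 √3) ℤ²`, preprint p. 1)] -/
theorem sub_mem_triangularLattice {p q : Plane} (hp : p ∈ triangularLattice)
    (hq : q ∈ triangularLattice) : p - q ∈ triangularLattice := by
  obtain ⟨a, rfl⟩ := hp
  obtain ⟨b, rfl⟩ := hq
  exact ⟨a - b, by rw [map_sub]⟩

/-- `A₂` is closed under addition. [cite: Theil2006, §1 (`A₂ = ½ (2 1; 0 √3) ℤ²`, preprint p. 1)] -/
theorem add_mem_triangularLattice {p q : Plane} (hp : p ∈ triangularLattice)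
    (hq : q ∈ triangularLattice) : p + q ∈ triangularLattice := by
  obtain ⟨a, rfl⟩ := hp
  obtain ⟨b, rfl⟩ := hq
  exact ⟨a + b, by rw [map_add]⟩

/-- `b₁ = triPoint (1, 0)` (private plumbing). [folklore] -/
private theorem triPoint_one_zero : triPoint (1, 0) = triVec₁ := by
  rw [triPoint_apply]
  simp

/-- `b₂ = triPoint (0, 1)` (private plumbing). [folklore] -/
private theorem triPoint_zero_one : triPoint (0, 1) = triVec₂ := by
  rw [triPoint_apply]
  simp

/-- The unit vectors of `A₂` are exactly the six nearest neighbours of the origin,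
`triPoint ξ`, `ξ ∈ unitShell` (Remark 2.5: `#{η' ∈ A₂ | |η - η'| ∈ (0,1]} = 6`).
[cite: Theil2006, §2.3 Remark 2.5 (preprint p. 7)] -/
theorem norm_triPoint_eq_one_iff {k : ℤ × ℤ} : ‖triPoint k‖ = 1 ↔ k ∈ unitShell := by
  refine ⟨fun h => ?_, norm_triPoint_of_mem_unitShell⟩
  by_contra hk
  by_cases hk0 : k = 0
  · subst hk0
    simp at h
  · have h3 := sqrt_three_le_norm_triPoint hk0 hk
    rw [h] at h3
    have h13 : (1 : ℝ) < Real.sqrt 3 := by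
      rw [show (1 : ℝ) = Real.sqrt 1 by simp]
      exact Real.sqrt_lt_sqrt (by norm_num) (by norm_num)
    linarith

/-- A linear isometry `R` of `ℝ²` with `R b₁, R b₂ ∈ A₂` maps every lattice point into `A₂`
(`R (m b₁ + n b₂) = m R b₁ + n R b₂`). [cite: Theil2006, §3 Proofs of Theorem 1.2 and Corollary 1.3, the «R = Id» reduction (preprint pp. 14–15); our lemma] -/
theorem map_triPoint_mem_triangularLattice {R : Plane ≃ₗᵢ[ℝ] Plane}
    (h₁ : R triVec₁ ∈ triangularLattice) (h₂ : R triVec₂ ∈ triangularLattice) (k : ℤ × ℤ) :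
    R (triPoint k) ∈ triangularLattice := by
  obtain ⟨a, ha⟩ := h₁
  obtain ⟨b, hb⟩ := h₂
  refine ⟨k.1 • a + k.2 • b, ?_⟩
  rw [map_add, map_zsmul, map_zsmul, ha, hb, triPoint_apply, map_add, LinearIsometryEquiv.map_smul,
    LinearIsometryEquiv.map_smul, Int.cast_smul_eq_zsmul, Int.cast_smul_eq_zsmul]

/-- **The point symmetries of `A₂` inside `O(2)`.** A linear isometry `R` of `ℝ²` with
`R b₁, R b₂ ∈ A₂` maps `A₂` ONTO itself: `R A₂ ⊆ A₂` by linearity, and `R` permutes the finite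
set of the six unit vectors of `A₂` (it maps it injectively into itself), so `b₁, b₂ ∈ R A₂` and
`R⁻¹ A₂ ⊆ A₂` as well. This is the lattice-symmetry fact behind the paper's reduction
«we can choose `R = Id`» once `R` is known to map two clamped bonds into `A₂`.
[cite: Theil2006, §3 Proofs of Theorem 1.2 and Corollary 1.3, the «R = Id» reduction (preprint pp. 14–15); our lemma] -/
theorem image_triangularLattice_eq {R : Plane ≃ₗᵢ[ℝ] Plane}
    (h₁ : R triVec₁ ∈ triangularLattice) (h₂ : R triVec₂ ∈ triangularLattice) :
    R '' triangularLattice = triangularLattice := by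
  classical
  -- the six unit vectors of `A₂`
  have hSfin : ({p ∈ triangularLattice | ‖p‖ = 1} : Set Plane).Finite := by
    refine ((unitShell.finite_toSet).image triPoint).subset ?_
    rintro p ⟨⟨k, rfl⟩, hk⟩
    exact ⟨k, Finset.mem_coe.2 (norm_triPoint_eq_one_iff.1 hk), rfl⟩
  have hmaps : Set.MapsTo R {p ∈ triangularLattice | ‖p‖ = 1} {p ∈ triangularLattice | ‖p‖ = 1} := by
    rintro p ⟨⟨k, rfl⟩, hk⟩
    exact ⟨map_triPoint_mem_triangularLattice h₁ h₂ k, by rw [R.norm_map]; exact hk⟩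
  have hsurj := ((hSfin.injOn_iff_bijOn_of_mapsTo hmaps).1 R.injective.injOn).surjOn
  -- hence `R⁻¹ b₁, R⁻¹ b₂ ∈ A₂`
  have hb₁ : triVec₁ ∈ {p ∈ triangularLattice | ‖p‖ = 1} :=
    ⟨triVec₁_mem_triangularLattice, by rw [← triPoint_one_zero, norm_triPoint_of_mem_unitShell (by decide)]⟩
  have hb₂ : triVec₂ ∈ {p ∈ triangularLattice | ‖p‖ = 1} :=
    ⟨⟨(0, 1), triPoint_zero_one⟩, by rw [← triPoint_zero_one, norm_triPoint_of_mem_unitShell (by decide)]⟩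
  obtain ⟨s₁, ⟨hs₁, -⟩, hRs₁⟩ := hsurj hb₁
  obtain ⟨s₂, ⟨hs₂, -⟩, hRs₂⟩ := hsurj hb₂
  have h₁' : R.symm triVec₁ ∈ triangularLattice := by
    rw [← hRs₁, R.symm_apply_apply]
    exact hs₁
  have h₂' : R.symm triVec₂ ∈ triangularLattice := by
    rw [← hRs₂, R.symm_apply_apply]
    exact hs₂
  apply Set.Subset.antisymm
  · rintro _ ⟨_, ⟨k, rfl⟩, rfl⟩
    exact map_triPoint_mem_triangularLattice h₁ h₂ k
  · rintro _ ⟨k, rfl⟩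
    refine ⟨R.symm (triPoint k), map_triPoint_mem_triangularLattice h₁' h₂' k, ?_⟩
    rw [R.apply_symm_apply]

/-- **A rigid-motion copy of `A₂` through one undistorted corner is `A₂`.** If `RΩ + τ = A₂` for
a linear isometry `R` and a translation `τ`, and `Ω` contains a lattice point `x₀` together with
its two neighbours `x₀ + b₁`, `x₀ + b₂`, then `Ω = A₂`: `R b₁ = (R(x₀+b₁)+τ) - (Rx₀+τ) ∈ A₂` and
likewise `R b₂`, so `R A₂ = A₂` (`image_triangularLattice_eq`), then `τ = (Rx₀ + τ) - Rx₀ ∈ A₂`,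
and `Ω = R⁻¹(A₂ - τ) = A₂`. This is what the reduction «we can choose `R = Id` … we obtain that
`τ = 0`» (p. 15) amounts to for a configuration that is undistorted somewhere (clamped far field).
[cite: Theil2006, §3 Proof of Corollary 1.3, last paragraph (preprint p. 15)] -/
theorem eq_triangularLattice_of_corner_mem {Ω : Set Plane} {R : Plane ≃ₗᵢ[ℝ] Plane} {τ : Plane}
    (hR : (fun p => R p + τ) '' Ω = triangularLattice) {k₀ : ℤ × ℤ} (hx₀ : triPoint k₀ ∈ Ω)
    (hx₁ : triPoint (k₀ + (1, 0)) ∈ Ω) (hx₂ : triPoint (k₀ + (0, 1)) ∈ Ω) :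
    Ω = triangularLattice := by
  have hmem : ∀ p ∈ Ω, R p + τ ∈ triangularLattice := fun p hp => hR ▸ ⟨p, hp, rfl⟩
  -- `R b₁, R b₂ ∈ A₂`
  have h₁ : R triVec₁ ∈ triangularLattice := by
    have e : R triVec₁ = (R (triPoint (k₀ + (1, 0))) + τ) - (R (triPoint k₀) + τ) := by
      rw [add_sub_add_right_eq_sub, ← map_sub, ← map_sub, add_sub_cancel_left, triPoint_one_zero]
    rw [e]
    exact sub_mem_triangularLattice (hmem _ hx₁) (hmem _ hx₀)
  have h₂ : R triVec₂ ∈ triangularLattice := by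
    have e : R triVec₂ = (R (triPoint (k₀ + (0, 1))) + τ) - (R (triPoint k₀) + τ) := by
      rw [add_sub_add_right_eq_sub, ← map_sub, ← map_sub, add_sub_cancel_left, triPoint_zero_one]
    rw [e]
    exact sub_mem_triangularLattice (hmem _ hx₂) (hmem _ hx₀)
  have hRA := image_triangularLattice_eq h₁ h₂
  -- `τ ∈ A₂`
  have hτ : τ ∈ triangularLattice := by
    have hR₀ : R (triPoint k₀) ∈ triangularLattice := by
      rw [← hRA]
      exact ⟨_, ⟨_, rfl⟩, rfl⟩
    have e : τ = (R (triPoint k₀) + τ) - R (triPoint k₀) := by abel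
    rw [e]
    exact sub_mem_triangularLattice (hmem _ hx₀) hR₀
  -- `Ω = R⁻¹ (A₂ - τ) = A₂`
  ext p
  constructor
  · intro hp
    have h2 : R p ∈ triangularLattice := by
      have := sub_mem_triangularLattice (hmem p hp) hτ
      rwa [add_sub_cancel_right] at this
    rw [← hRA] at h2
    obtain ⟨q, hq, hqp⟩ := h2
    rwa [← R.injective hqp]
  · intro hp
    have h2 : R p ∈ triangularLattice := by
      rw [← hRA]
      exact ⟨p, hp, rfl⟩
    have h1 := add_mem_triangularLattice h2 hτ
    rw [← hR] at h1
    obtain ⟨q, hq, hqp⟩ := h1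
    have hq' : q = p := R.injective (add_right_cancel hqp)
    exact hq' ▸ hq

/-- **A rigid-motion copy of `A₂` containing all but finitely many points of `A₂` is `A₂`**
(an undistorted corner exists beyond any finite set of labels).
[cite: Theil2006, §3 Proof of Corollary 1.3, last paragraph (preprint p. 15)] -/
theorem eq_triangularLattice_of_cofinite {Ω : Set Plane} {R : Plane ≃ₗᵢ[ℝ] Plane} {τ : Plane}
    (hR : (fun p => R p + τ) '' Ω = triangularLattice) {F : Finset (ℤ × ℤ)}
    (hF : ∀ k ∉ F, triPoint k ∈ Ω) : Ω = triangularLattice := by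
  classical
  obtain ⟨M, hM⟩ := (F.image Prod.fst).bddAbove
  have hout : ∀ k : ℤ × ℤ, M < k.1 → triPoint k ∈ Ω := fun k hk =>
    hF k fun hkF => by
      have : k.1 ≤ M := hM (Finset.mem_coe.2 (Finset.mem_image_of_mem Prod.fst hkF))
      exact absurd hk (not_lt.2 this)
  exact eq_triangularLattice_of_corner_mem hR (k₀ := (M + 1, 0)) (hout _ (by simp))
    (hout _ (by simp)) (hout _ (by simp))

/-- **Corollary 1.3, last step, for clamped configurations.** If `y : A₂ → ℝ²` is clamped
outside a finite set `𝒜` (`y(x) = x` for `x ∉ 𝒜`, `Theil2006.IsClampedOutside`) and its image is a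
rigid-motion copy of `A₂` in the form delivered by p. 13, `{R y(x) + τ | x ∈ A₂} = A₂` for a linear
isometry `R` and a translation `τ`, then already `{y(x) | x ∈ A₂} = A₂` — the conclusion of
`Theil2006_dirichletGroundStates`: the clamped far field contains an undistorted corner
(`eq_triangularLattice_of_cofinite`). This is what «we can choose `R = Id` … we obtain that
`τ = 0`» (p. 15) amounts to. [cite: Theil2006, §3 Proof of Corollary 1.3, last paragraph (preprint p. 15)] -/
theorem IsClampedOutside.range_eq_triangularLattice_of_rotation {A : Finset (ℤ × ℤ)}
    {y : ℤ × ℤ → Plane} (hy : IsClampedOutside A y) {R : Plane ≃ₗᵢ[ℝ] Plane} {τ : Plane}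
    (hR : Set.range (fun k => R (y k) + τ) = triangularLattice) :
    Set.range y = triangularLattice := by
  refine eq_triangularLattice_of_cofinite (R := R) (τ := τ) (F := A) ?_ fun k hk => ⟨k, hy k hk⟩
  rw [← hR, ← Set.range_comp]
  rfl

/-- **Corollary 1.3, last step, for clamped configurations.** If `y : A₂ → ℝ²` is clamped
outside a finite set `𝒜` (`y(x) = x` for `x ∉ 𝒜`, `Theil2006.IsClampedOutside`) and its image
`Ω = {y(x)}` satisfies (42) and (43), then `{y(x) | x ∈ A₂} = A₂` — the conclusion of
`Theil2006_dirichletGroundStates`; the rotation and translation provided by p. 13 are absorbed by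
the clamped far field (`range_eq_triangularLattice_of_rotation`), which is what «we can choose `R = Id` …
we obtain that `τ = 0`» (p. 15) amounts to. [cite: Theil2006, §3 Proof of Corollary 1.3, last paragraph (preprint p. 15)] -/
theorem IsClampedOutside.range_eq_triangularLattice {A : Finset (ℤ × ℤ)} {y : ℤ × ℤ → Plane}
    (hy : IsClampedOutside A y) (h42 : ∀ k k' : ℤ × ℤ, y k ≠ y k' → 1 ≤ dist (y k) (y k'))
    (h43 : ∀ k : ℤ × ℤ, {p ∈ Set.range y | dist (y k) p ≤ 1}.ncard = 7) :
    Set.range y = triangularLattice := by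
  obtain ⟨-, R, -, τ, hR⟩ := exists_rotation_range_eq_triangularLattice h42 h43
  exact hy.range_eq_triangularLattice_of_rotation hR

/-- For a clamped configuration the conclusion of Corollary 1.3, `{y(x) | x ∈ A₂} = A₂`, is
EQUIVALENT to (42) ∧ (43) for its image (⇐: `IsClampedOutside.range_eq_triangularLattice`;
⇒: `A₂` satisfies (42)–(43), `Theil2006LatticeCharacterization.lean` §4). So the printed route through (42)–(43) loses nothing.
[cite: Theil2006, §3 Proof of Corollary 1.3, last paragraph (preprint p. 15)] -/
theorem IsClampedOutside.range_eq_triangularLattice_iff {A : Finset (ℤ × ℤ)} {y : ℤ × ℤ → Plane}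
    (hy : IsClampedOutside A y) :
    Set.range y = triangularLattice ↔
      (∀ k k' : ℤ × ℤ, y k ≠ y k' → 1 ≤ dist (y k) (y k')) ∧
        ∀ k : ℤ × ℤ, {p ∈ Set.range y | dist (y k) p ≤ 1}.ncard = 7 := by
  refine ⟨fun h => ⟨fun k k' hkk' => ?_, fun k => ?_⟩, fun h => hy.range_eq_triangularLattice h.1 h.2⟩
  · exact triangularLattice_sep _ (h ▸ ⟨k, rfl⟩) _ (h ▸ ⟨k', rfl⟩) hkk'
  · rw [h]
    exact ncard_triangularLattice_closedBall _ (h ▸ ⟨k, rfl⟩)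

end Theil2006

/-! ## §6 Reductions of Theorem 1.2 (rotation form) and Corollary 1.3 to (42)–(43) -/

open Theil2006 in
/-- **Reduction (ours) for Theorem 1.2 in the form its proof establishes.** The printed proof
(p. 14) ends: «Hence, the set `Ω = {y_min(x) | x ∈ A₂}` satisfies (42) and (43) and
consequentially `RΩ + τ = A₂` for a rotation `R ∈ SO(2)` and a translation `τ ∈ ℝ²`.» With the
p. 13 statement now a theorem (`exists_rotation_range_eq_triangularLattice`), the named fact
`Theil2006_periodicGroundStates_upToRotation` follows from (42) ∧ (43) for the images of periodic
ground states — the remaining (analytic) content of §3: `#X̃_min = L²`, `∂X̃_min = ∅`, all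
short bonds of length exactly `1` (p. 14). [cite: Theil2006, §3 Proof of Theorem 1.2 (preprint pp. 13–14)] -/
theorem Theil2006_periodicGroundStates_upToRotation_of_local
    (h : ∃ α₀ : ℝ, 0 < α₀ ∧ α₀ < 1 / 3 ∧ ∀ α : ℝ, 0 < α → α < α₀ → ∀ L : ℕ, 0 < L →
      ∀ V : ℝ → ℝ, IsAdmissible α V → ∀ y : ℤ × ℤ → Plane, IsPeriodic L y →
        (∀ y' : ℤ × ℤ → Plane, IsPeriodic L y' → periodicEnergy V L y ≤ periodicEnergy V L y') →
          (∀ k k' : ℤ × ℤ, y k ≠ y k' → 1 ≤ dist (y k) (y k')) ∧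
            ∀ k : ℤ × ℤ, {p ∈ Set.range y | dist (y k) p ≤ 1}.ncard = 7) :
    Theil2006_periodicGroundStates_upToRotation := by
  obtain ⟨α₀, hα₀, hα₀', hmain⟩ := h
  refine ⟨α₀, hα₀, hα₀', fun α hα hα' L hL V hV y hy hmin => ?_⟩
  obtain ⟨h42, h43⟩ := hmain α hα hα' L hL V hV y hy hmin
  obtain ⟨-, R, -, τ, hR⟩ := exists_rotation_range_eq_triangularLattice h42 h43
  exact ⟨R, τ, hR⟩

open Theil2006 in
/-- **Reduction (ours) for Corollary 1.3.** `Theil2006_dirichletGroundStates` follows from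
(42) ∧ (43) for the images of clamped ground states (`IsClampedOutside.range_eq_triangularLattice`;
by `IsClampedOutside.range_eq_triangularLattice_iff` this hypothesis is also necessary). The
printed proof (p. 15) establishes (42)–(43) for the periodized configuration `y_per` (which agrees
with `y_min` on the period cell `Y ⊇ 𝒜`) via (44)–(46) and then transfers; that analytic part is
not formalized here. [cite: Theil2006, §3 Proof of Corollary 1.3 (preprint pp. 14–15)] -/
theorem Theil2006_dirichletGroundStates_of_local
    (h : ∃ α₀ : ℝ, 0 < α₀ ∧ α₀ < 1 / 3 ∧ ∀ α : ℝ, 0 < α → α < α₀ → ∀ V : ℝ → ℝ, IsAdmissible α V →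
      ∀ (A : Finset (ℤ × ℤ)) (y : ℤ × ℤ → Plane), IsClampedOutside A y →
        (∀ y' : ℤ × ℤ → Plane, IsClampedOutside A y' →
            dirichletEnergy V A y ≤ dirichletEnergy V A y') →
          (∀ k k' : ℤ × ℤ, y k ≠ y k' → 1 ≤ dist (y k) (y k')) ∧
            ∀ k : ℤ × ℤ, {p ∈ Set.range y | dist (y k) p ≤ 1}.ncard = 7) :
    Theil2006_dirichletGroundStates := by
  obtain ⟨α₀, hα₀, hα₀', hmain⟩ := h
  refine ⟨α₀, hα₀, hα₀', fun α hα hα' V hV A y hy hmin => ?_⟩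
  obtain ⟨h42, h43⟩ := hmain α hα hα' V hV A y hy hmin
  exact hy.range_eq_triangularLattice h42 h43

end Literature.MathematicalPhysics.StatisticalMechanics

end
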